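import Mathlib
import Summits.ValiantsHypothesis.ValiantsHypothesis.Theorems.BarrierLeverDefinableEquationsProductDepthWallTwoMerge
import Summits.ValiantsHypothesis.ValiantsHypothesis.Theorems.BarrierLeverDefinableEquationsProductDepthWall

/-!
# Route BarrierLever — crux `DefinableEquations` (stmt-8745) / item `SingleSizeEquations`
# (stmt-8749): LST's word polynomial IN ITS OWN (INDEX) ORDER costs `≤ 2dn` — the placed `e_*(P_w)`
# itself lies in `SmallCircuits ℂ n 3` (val-np-p5 g15, addendum to `…ProductDepthWallTwo*`)

The sparse-automaton engine (`complexity_acceptedPoly_le`, part 1) applied to LST's queue automaton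
WITHOUT reordering the blocks: under the side condition `2^{|w_{[t]}|} ≤ n` of the tree's `wordSubst`
(all `t ≤ d`) and with every block embedded among `x_1, …, x_n`, each layer has at most `n`
transitions (`edges_wordStep_le_of_side`: a push has `2^{|w_{[t+1]}|} ≤ n`, a compare
`2^{max(|w_{[t]}|,|w_t|)} ≤ n`), so `L(P_w) ≤ 2dn` (`complexity_wordPoly_le_index`; the tree's
`ProductDepthWall.complexity_wordPoly_le` gives `n + 2n³d + dn³` through the dense `IMM_{n,d}`).
Hence g10's witness `e_*(P_w)` verbatim has complexity `≤ 2n²` and lies in `SmallCircuits ℂ n 3`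
for `n ≥ 2` (`exists_fullPdRank_complexity_le_index`, `placedWordPoly_mem_smallCircuits_three`) —
the "all data, sharper ABP count" line of LANDSCAPE-8749-g14 §3(i).  The quadratic count is sharp
in order of magnitude for index order (pushes onto non-empty overhangs); the wall at `b = 2` /
linear size (`…ProductDepthWallTwo.lean`) needs the merge reordering.

What this is NOT: nothing on the crux (b = 2 OPEN, Chatterjee–Tengse §1.3 dir. 2) or `VP ≠ VNP`;
no definitions, no named facts, standard axioms.
Refs: Limaye–Srinivasan–Tavenas, J. ACM 72 (2025) Art. 26, Lemma 8, Lemma 22; Bürgisser 2000, Rem. 2.7.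
-/

-- `Summit.ValiantsHypothesis.ValiantsHypothesis.…` repeats a component (D-0017 layout); mandated.
set_option linter.dupNamespace false

noncomputable section

namespace Summit.ValiantsHypothesis.ValiantsHypothesis.Theorems.BarrierLeverDefinableEquations

open MvPolynomial
open Literature.Computability.AlgebraicComplexity
open Literature.Computability.AlgebraicComplexity.LSTWord
open Literature.Barriers.ValiantsHypothesis
open scoped BigOperators

namespace ProductDepthWallTwo

variable {D : ℕ} (k : ℕ) (pos : Fin D → Bool)

/-- **At most `n` transitions per layer in index order**: if the states of layers `t` and `t+1`
and the labels of block `t` each number at most `n`, layer `t` of the queue automaton has `≤ n`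
transitions (push: `2^{|w_{[t]}|+|w_t|} = 2^{|w_{[t+1]}|}`; compare: `2^{max(|w_{[t]}|,|w_t|)}`).
[cite: LimayeSrinivasanTavenas2025, Lemma 22] -/
theorem edges_wordStep_le_of_side {n : ℕ} (t : Fin D) (hov : 2 ^ overLen k pos t ≤ n)
    (hov' : 2 ^ overLen k pos (t.val + 1) ≤ n) (hls : 2 ^ letterSize k pos t ≤ n) :
    edges (St := fun t => List.Vector Bool (overLen k pos t)) (wordStep k pos) t ≤ n := by
  by_cases hle : streamLen k pos (!pos t) t ≤ streamLen k pos (pos t) t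
  · refine (edges_wordStep_le k pos t).trans ?_
    rwa [← pow_add, ← overLen_succ_of_le k pos t hle]
  · refine (edges_wordStep_le_of_lt k pos t (not_le.1 hle)).trans ?_
    rcases le_total (overLen k pos t) (letterSize k pos t) with h | h
    · rwa [max_eq_right h]
    · rwa [max_eq_left h]

/-- **`L(P_w) ≤ 2dn` in index order** under the side condition `2^{|w_{[t]}|} ≤ n` (`t ≤ d`) and
with the blocks embedded among `n` variables (sparse count; the tree's bound through the dense
`IMM_{n,d}` is `n + 2n³d + dn³`). [cite: LimayeSrinivasanTavenas2025, Lemma 8] -/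
theorem complexity_wordPoly_le_index (K : Type*) [CommSemiring K] {n : ℕ}
    (hn : ∀ t ≤ D, 2 ^ overLen k pos t ≤ n) (e : (Σ i : Fin D, BlockVar k pos i) ↪ Fin n) :
    complexity (wordPoly k pos K) ≤ 2 * D * n := by
  classical
  rw [wordPoly_eq_acceptedPoly]
  refine (complexity_acceptedPoly_le (K := K) (St := fun t => List.Vector Bool (overLen k pos t))
    (wordStart k pos) (wordStep k pos)).trans ?_
  rw [mul_assoc]
  refine Nat.mul_le_mul_left _ ?_
  calc ∑ t : Fin D, edges (St := fun t => List.Vector Bool (overLen k pos t)) (wordStep k pos) t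
      ≤ ∑ _t : Fin D, n := Finset.sum_le_sum fun t _ =>
        edges_wordStep_le_of_side k pos t (hn t (Nat.le_of_lt t.2)) (hn (t.val + 1) t.2)
          (by rw [← card_blockVar]; exact ProductDepthWall.card_blockVar_le k pos e t)
    _ = D * n := by rw [Finset.sum_const, Finset.card_univ, Fintype.card_fin, smul_eq_mul]

/-- g10's witness `e_*(P_w)` VERBATIM (no reordering): degree `≤ n`, complexity `≤ 2n²`, full
block rank — sharpening `ProductDepthWall.exists_fullPdRank_complexity_le` (`n + 3n⁴`).
[cite: LimayeSrinivasanTavenas2025, §2.2 and Lemma 8] -/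
theorem exists_fullPdRank_complexity_le_index {n : ℕ} (hdn : D ≤ n)
    (hn : ∀ t ≤ D, 2 ^ overLen k pos t ≤ n) (e : (Σ i : Fin D, BlockVar k pos i) ↪ Fin n) :
    (rename e (wordPoly k pos ℂ)).totalDegree ≤ n ∧ complexity (rename e (wordPoly k pos ℂ)) ≤ 2 * n ^ 2 ∧
      pdRank ℂ (posBlocks pos) (negBlocks pos) (killCompl e.injective (rename e (wordPoly k pos ℂ))) =
        2 ^ min (streamLen k pos true D) (streamLen k pos false D) := by
  refine ⟨(totalDegree_rename_le _ _).trans ((ProductDepthWall.totalDegree_wordPoly_le k pos).trans hdn),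
    ?_, ?_⟩
  · refine (complexity_rename_le_holds' (k := ℂ) e _).trans
      ((complexity_wordPoly_le_index k pos ℂ hn e).trans ?_)
    calc 2 * D * n ≤ 2 * n * n := by gcongr
      _ = 2 * n ^ 2 := by ring
  · rw [killCompl_rename_app]
    exact pdRank_wordPoly k pos ℂ

/-- Hence `e_*(P_w) ∈ SmallCircuits ℂ n b` for every `b ≥ 3` and `n ≥ 2` (g10: `b = 5`, `n ≥ 4`).
[cite: ForbesShpilkaVolk2018, Cor. 5] -/
theorem placedWordPoly_mem_smallCircuits_three {n : ℕ} (h2 : 2 ≤ n) (hdn : D ≤ n)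
    (hn : ∀ t ≤ D, 2 ^ overLen k pos t ≤ n) (e : (Σ i : Fin D, BlockVar k pos i) ↪ Fin n)
    {b : ℕ} (hb : 3 ≤ b) :
    rename e (wordPoly k pos ℂ) ∈ SmallCircuits ℂ n b := by
  obtain ⟨hdeg, hL, -⟩ := exists_fullPdRank_complexity_le_index k pos hdn hn e
  refine ⟨hdeg, hL.trans ?_⟩
  calc 2 * n ^ 2 ≤ n * n ^ 2 := Nat.mul_le_mul_right _ h2
    _ = n ^ 3 := by ring
    _ ≤ n ^ b := Nat.pow_le_pow_right (by omega) hb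

end ProductDepthWallTwo

end Summit.ValiantsHypothesis.ValiantsHypothesis.Theorems.BarrierLeverDefinableEquations
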